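import Summits.QuantumFields.YangMills.Theorems.FluctuationComparisonRegPrIntLOrganTangentFibredChartBridgeIntegrandAnyCut
import Summits.QuantumFields.YangMills.Theorems.FluctuationComparisonRegPrIntLOrganTangentTriangularChart
import Literature.MathematicalPhysics.QuantumFieldTheory.Balaban1983to89.T4TriangularFibredChart
import Literature.MathematicalPhysics.QuantumFieldTheory.Balaban1983to89.BlockAveragingHaarAC
import HarnessLib

/-!
# Crux `FluctuationComparisonRegPrIntL` (stmt-QuantumFields-20520, rung R3), PATH-B organ-tangent lane — THE TRIANGULAR CHART AT `descend` (L5),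
# GENERIC CUT: ✓`…OrganTangentTriangularChart` (p782575, LEAD w3 g22) §3 with `3 ∕ 4 ↦ cW`

LEAD-20520 width seat ym-ust-20520-w3 g23 (cell ym3-torus), `--supports stmt-QuantumFields-20520` (helper).  THEOREMS ONLY, def-free.  §1–§2 of the
landed file (`isLocal_descend`, `injective_private`, `continuous_extend_left`) are cut-free and are IMPORTED, not re-declared; §3
★★`regularPackage_of_oneVariableInverseLaws` is the landed statement and proof BYTE FOR BYTE except that the window constant `3 ∕ 4` is the free
binder `(cW : ℝ)` (in `hmargin`, `hΩS`, `hmass` and the (A1)(A2)(A3) conclusion), assembled through the generic-cut bridge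
✓`…OrganTangentFibredChartBridgeIntegrandAnyCut`.

WHY A GENERIC-CUT EDITION (R-CUT-χ, LEAD WORD №1 (iii) ∕ ideator ym-r3-idea-1 g26 №3 «GO v2.6 ∕ v17.2», 2026-08-30).  Row VER∘ needs every
coarse-window fibre of `descend` to meet `{χ > 0} = {PlaqSmall (c₂·θ_{j+1})}`, `c₂θ` the TOP of the cutoff ramp — i.e. exact one-step small lifts with
gain `κ√L ≤ c₂` from a height.  The tree's certified kernels give `κ√L ≤ 0.9482…` at `L = 3` (`CertL3Tree.certL3_clause`), `0.860 ∕ 0.805` at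
`L = 5 ∕ 7` (ANSATZ S), `≤ 2∕3` for odd `L ≥ 9` (ANSATZ T): the v2–v2.5 top `cW` is served for `L ≥ 9` only (✓`…SpreadLiftOfSmallLift`), any top in
`(0.9483, 1)` for EVERY odd `L ≥ 3`.  The line therefore re-cut `sfCut` to the ramp `(c₁, c₂) = (1∕2, 24∕25)` (token of record:
`∏ p, max 0 (min 1 ((24 ∕ 25 * θ − dist1 (plaqHol U p)) ∕ ((24 ∕ 25 − 1 ∕ 2) * θ)))`), and the (A)-currency files are re-issued with the window
constant a FREE real `cW` in place of the literal `3 ∕ 4` (consumers instantiate `cW := 24 ∕ 25`; `cW := 3 ∕ 4` recovers the landed edition).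

CONTENT: per coarse bond `c` (private fine bond `β c := centralBond (bondShift (sitesPerDir_descend F j 0) c)`): one-bond domains `Ω_c(U)` (blind to
the private coordinates), `T_c(U) ⊇ T′_c(U)`, a local inverse `θ_c(U, ·)` (`hright`), a density `jac_c(U, ·)` with the INVERSE LAW `hlaw`
(`T4TriangularFibredChart` shapes VERBATIM at `A := descend F ℰp j`), margins `hT'T`∕`hmargin`∕`hΩS`, a measurable section `s`, continuity
`hθc`∕`hjc`, bound `hjM`, and the MASS letter `hmass` ⟹ the (A)-package for every disintegration `σ₀`.
[cite: Balaban1987RG1, (0.4) p.253, (2.4) p.266 and (2.10) p.267; Balaban1985Averaging, (10) p.19]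

HONEST FRAMING: a mechanical generalisation (`3 ∕ 4 ↦ cW`) of a landed, kernel-checked helper over hypothesis letters; nothing of Bałaban's
analysis is asserted or proved; (A), VER∘ (as a row), LIN∘, JEN∘, O1, crux 20520 `FluctuationComparisonRegPrIntL`, `YM3TorusSU2` are NOT proved; the
registry `Lines/semiclassical_s2beta.lean` v11.4 (★★OWNER RULING №36) is untouched and nothing here is registered; rung R3 = SU(2) YM₃ on T³ —
NOT d = 4, NOT infinite volume, NOT a mass gap, NOT Clay; the Yang–Mills mass gap is NOT proved by any of this.
-/

set_option autoImplicit false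

noncomputable section

namespace Summit.QuantumFields.YangMills.Theorems.OrganTangentTriangularChartAnyCut

open MeasureTheory ProbabilityTheory Filter Topology Set Function
open scoped ENNReal NNReal
open Literature.MathematicalPhysics.QuantumFieldTheory.Balaban1983to89
open T3ContinuumYM3Torus T3NestedUnitLaws T3UnitLawDensityEML T3UnitScaleTilt T3LevelShift
open Literature.MathematicalPhysics.QuantumFieldTheory.Balaban1983to89.T3OrbitAverage
open Literature.MathematicalPhysics.QuantumFieldTheory.Balaban1983to89.T4TriangularPushforward (IsLocal)
open Literature.MathematicalPhysics.QuantumFieldTheory.Balaban1983to89.BlockAveragingHaarAC (centralBond centralBond_injective isLocal_avgFun)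
open Summit.QuantumFields.YangMills.Theorems.OrganTangentFibreMeanTools
open Summit.QuantumFields.YangMills.Theorems.OrganTangentFibredChartBridgeIntegrandAnyCut
open Summit.QuantumFields.YangMills.Theorems.OrganTangentTriangularChart (isLocal_descend injective_private continuous_extend_left)

/-! ## §3 Per-bond one-variable inverse laws ⟹ the (A)-package -/

/-- ★ **PER-BOND ONE-VARIABLE INVERSE LAWS OF `descend` ⟹ THE (A)-PACKAGE.**  Per coarse bond `c` (private fine bond
`β c := centralBond (bondShift (sitesPerDir_descend F j 0) c)`): a fine one-bond domain `Ω_c(U)` blind to the private coordinates of the environment, a coarse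
one-bond domain `T_c(U)` containing every value `V c` of a window datum, a local inverse `θ_c(U, ·)` with `descend (update U (β c) (θ_c(U, v))) c = v` on
`T_c(U)`, continuous there, and a density `j_c(U, ·) ≥ 0`, continuous on `T_c(U)`, uniformly bounded, with the INVERSE LAW `dg⌊Ω_c(U) = θ_c(U,·)_*(j_c(U,·)·dv⌊T_c(U))`
(`T4TriangularFibredChart`'s `hright`∕`hlaw` VERBATIM at `A := descend F ℰp j`); the `cW·θ`-small fine fields have their private coordinates in the `Ω_c`; and the
MASS letter (C3) for the resulting chart.  Then the (A)-package of ✓`fibreMeanVersion_of_regularSmallFieldDisintegration` holds for every disintegration `σ₀`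
(via ✓`regularPackage_of_fibredChart` at the chart `Φ (V, U) := extend β (c ↦ θ_c(U, V c)) U`, `J := 𝟙[∀ c, V c ∈ T_c(U)]·∏_c j_c(U, V c)`, `τ := dU_{j+1}`).
[cite: Balaban1987RG1, (0.4) p.253, (2.4) p.266 and (2.10) p.267; Balaban1985Averaging, (10) p.19] -/
theorem regularPackage_of_oneVariableInverseLaws
    (F : T3Family) (γ b₀ p₀ : ℝ) (j : ℕ) (cW : ℝ)
    (σ₀ : Kernel (GaugeField (F.P j) 0 ↥(Matrix.specialUnitaryGroup (Fin 2) ℂ))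
      (GaugeField (F.P (j + 1)) 0 ↥(Matrix.specialUnitaryGroup (Fin 2) ℂ)))
    (hσ₀M : IsMarkovKernel σ₀)
    (hbind₀ : (Measure.map (descend F ℰp j) (fieldMeasure (F.P (j + 1)) 0 ↥(Matrix.specialUnitaryGroup (Fin 2) ℂ))).bind ⇑σ₀ =
      fieldMeasure (F.P (j + 1)) 0 ↥(Matrix.specialUnitaryGroup (Fin 2) ℂ))
    (hfib₀ : ∀ᵐ V ∂(Measure.map (descend F ℰp j) (fieldMeasure (F.P (j + 1)) 0 ↥(Matrix.specialUnitaryGroup (Fin 2) ℂ))),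
      ∀ᵐ U ∂(σ₀ V), descend F ℰp j U = V)
    (Ω T : PBond (F.P j) 0 → GaugeField (F.P (j + 1)) 0 ↥(Matrix.specialUnitaryGroup (Fin 2) ℂ) → Set ↥(Matrix.specialUnitaryGroup (Fin 2) ℂ))
    (θ : PBond (F.P j) 0 → GaugeField (F.P (j + 1)) 0 ↥(Matrix.specialUnitaryGroup (Fin 2) ℂ) →
      ↥(Matrix.specialUnitaryGroup (Fin 2) ℂ) → ↥(Matrix.specialUnitaryGroup (Fin 2) ℂ))
    (jac : PBond (F.P j) 0 → GaugeField (F.P (j + 1)) 0 ↥(Matrix.specialUnitaryGroup (Fin 2) ℂ) → ↥(Matrix.specialUnitaryGroup (Fin 2) ℂ) → ℝ≥0)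
    (hΩm : ∀ c, MeasurableSet {p : GaugeField (F.P (j + 1)) 0 ↥(Matrix.specialUnitaryGroup (Fin 2) ℂ) × ↥(Matrix.specialUnitaryGroup (Fin 2) ℂ) |
      p.2 ∈ Ω c p.1})
    (hTm : ∀ c, MeasurableSet {p : GaugeField (F.P (j + 1)) 0 ↥(Matrix.specialUnitaryGroup (Fin 2) ℂ) × ↥(Matrix.specialUnitaryGroup (Fin 2) ℂ) |
      p.2 ∈ T c p.1})
    (hθm : ∀ c, Measurable fun p : GaugeField (F.P (j + 1)) 0 ↥(Matrix.specialUnitaryGroup (Fin 2) ℂ) × ↥(Matrix.specialUnitaryGroup (Fin 2) ℂ) =>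
      θ c p.1 p.2)
    (hjm : ∀ c, Measurable fun p : GaugeField (F.P (j + 1)) 0 ↥(Matrix.specialUnitaryGroup (Fin 2) ℂ) × ↥(Matrix.specialUnitaryGroup (Fin 2) ℂ) =>
      jac c p.1 p.2)
    (hΩbl : ∀ c (U : GaugeField (F.P (j + 1)) 0 ↥(Matrix.specialUnitaryGroup (Fin 2) ℂ)) (g : PBond (F.P j) 0 → ↥(Matrix.specialUnitaryGroup (Fin 2) ℂ)),
      Ω c (extend (fun c : PBond (F.P j) 0 => centralBond (bondShift (sitesPerDir_descend F j 0) c)) g U) = Ω c U)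
    (hright : ∀ c U, ∀ v ∈ T c U,
      descend F ℰp j (update U (centralBond (bondShift (sitesPerDir_descend F j 0) c)) (θ c U v)) c = v)
    (hlaw : ∀ c U, (HaarData.haar : Measure ↥(Matrix.specialUnitaryGroup (Fin 2) ℂ)).restrict (Ω c U) =
      (((HaarData.haar : Measure ↥(Matrix.specialUnitaryGroup (Fin 2) ℂ)).restrict (T c U)).withDensity fun v => (jac c U v : ℝ≥0∞)).map (θ c U))
    (T' : PBond (F.P j) 0 → GaugeField (F.P (j + 1)) 0 ↥(Matrix.specialUnitaryGroup (Fin 2) ℂ) → Set ↥(Matrix.specialUnitaryGroup (Fin 2) ℂ))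
    (hTo : ∀ c U, IsOpen (T c U)) (hT'T : ∀ c U, closure (T' c U) ⊆ T c U)
    (hmargin : ∀ (U : GaugeField (F.P (j + 1)) 0 ↥(Matrix.specialUnitaryGroup (Fin 2) ℂ)) (V : GaugeField (F.P j) 0 ↥(Matrix.specialUnitaryGroup (Fin 2) ℂ)),
      PlaqSmall (θBal F.L γ b₀ p₀ j) V → (∀ c, V c ∈ T c U) →
      PlaqSmall (cW * θBal F.L γ b₀ p₀ (j + 1))
        (extend (fun c : PBond (F.P j) 0 => centralBond (bondShift (sitesPerDir_descend F j 0) c)) (fun c => θ c U (V c)) U) →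
      ∀ c, V c ∈ T' c U)
    (s : GaugeField (F.P j) 0 ↥(Matrix.specialUnitaryGroup (Fin 2) ℂ) → GaugeField (F.P (j + 1)) 0 ↥(Matrix.specialUnitaryGroup (Fin 2) ℂ))
    (hsm : Measurable s) (hs : ∀ V, PlaqSmall (θBal F.L γ b₀ p₀ j) V → descend F ℰp j (s V) = V)
    (hΩS : ∀ (U : GaugeField (F.P (j + 1)) 0 ↥(Matrix.specialUnitaryGroup (Fin 2) ℂ)), PlaqSmall (cW * θBal F.L γ b₀ p₀ (j + 1)) U →
      ∀ c, U (centralBond (bondShift (sitesPerDir_descend F j 0) c)) ∈ Ω c U)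
    (hθc : ∀ c U, ContinuousOn (θ c U) (T c U))
    (hjc : ∀ c U, ContinuousOn (fun v => (jac c U v : ℝ)) (T c U))
    (M : ℝ≥0) (hjM : ∀ c U v, jac c U v ≤ M)
    (hmass : ∀ V : GaugeField (F.P j) 0 ↥(Matrix.specialUnitaryGroup (Fin 2) ℂ), PlaqSmall (θBal F.L γ b₀ p₀ j) V →
      0 < ∫⁻ U in {U : GaugeField (F.P (j + 1)) 0 ↥(Matrix.specialUnitaryGroup (Fin 2) ℂ) | (∀ c, V c ∈ T c U) ∧
          PlaqSmall (cW * θBal F.L γ b₀ p₀ (j + 1))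
            (extend (fun c : PBond (F.P j) 0 => centralBond (bondShift (sitesPerDir_descend F j 0) c)) (fun c => θ c U (V c)) U)},
        ∏ c, (jac c U (V c) : ℝ≥0∞) ∂(fieldMeasure (F.P (j + 1)) 0 ↥(Matrix.specialUnitaryGroup (Fin 2) ℂ))) :
    ∃ lam : GaugeField (F.P j) 0 ↥(Matrix.specialUnitaryGroup (Fin 2) ℂ) →
        Measure (GaugeField (F.P (j + 1)) 0 ↥(Matrix.specialUnitaryGroup (Fin 2) ℂ)),
      (∀ V, IsFiniteMeasure (lam V)) ∧
      (∀ f : GaugeField (F.P (j + 1)) 0 ↥(Matrix.specialUnitaryGroup (Fin 2) ℂ) → ℝ, Continuous f →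
        (∀ U, f U ≠ 0 → PlaqSmall (cW * θBal F.L γ b₀ p₀ (j + 1)) U) →
        ContinuousOn (fun V => ∫ U, f U ∂(lam V)) {V | PlaqSmall (θBal F.L γ b₀ p₀ j) V}) ∧
      (∀ V, PlaqSmall (θBal F.L γ b₀ p₀ j) V → 0 < lam V {U | PlaqSmall (cW * θBal F.L γ b₀ p₀ (j + 1)) U}) ∧
      (∃ c : GaugeField (F.P j) 0 ↥(Matrix.specialUnitaryGroup (Fin 2) ℂ) → ℝ,
        ∀ f : GaugeField (F.P (j + 1)) 0 ↥(Matrix.specialUnitaryGroup (Fin 2) ℂ) → ℝ, Continuous f →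
          (∀ U, ¬ PlaqSmall (cW * θBal F.L γ b₀ p₀ (j + 1)) U → f U = 0) →
          ∀ᵐ V ∂(Measure.map (descend F ℰp j) (fieldMeasure (F.P (j + 1)) 0 ↥(Matrix.specialUnitaryGroup (Fin 2) ℂ))),
            PlaqSmall (θBal F.L γ b₀ p₀ j) V → 0 < c V ∧ ∫ U, f U ∂(σ₀ V) = c V * ∫ U, f U ∂(lam V)) := by
  classical
  -- names
  set β : PBond (F.P j) 0 → PBond (F.P (j + 1)) 0 := fun c => centralBond (bondShift (sitesPerDir_descend F j 0) c) with hβ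
  have hβi : Injective β := injective_private F j
  have hloc : IsLocal β (descend F ℰp j : GaugeField (F.P (j + 1)) 0 ↥(Matrix.specialUnitaryGroup (Fin 2) ℂ) →
      GaugeField (F.P j) 0 ↥(Matrix.specialUnitaryGroup (Fin 2) ℂ)) := isLocal_descend F j
  have hd : Measurable (descend F ℰp j :
      GaugeField (F.P (j + 1)) 0 ↥(Matrix.specialUnitaryGroup (Fin 2) ℂ) →
        GaugeField (F.P j) 0 ↥(Matrix.specialUnitaryGroup (Fin 2) ℂ)) :=
    T3NestedUnitLaws.measurable_descend F ℰp measurableE_ℰp j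
  haveI : IsProbabilityMeasure (HaarData.haar : Measure ↥(Matrix.specialUnitaryGroup (Fin 2) ℂ)) := HaarData.isProb
  haveI : Nonempty ↥(Matrix.specialUnitaryGroup (Fin 2) ℂ) := ⟨1⟩
  set θj : ℝ := θBal F.L γ b₀ p₀ j with hθj
  set θ' : ℝ := θBal F.L γ b₀ p₀ (j + 1) with hθ'
  set W : Set (GaugeField (F.P j) 0 ↥(Matrix.specialUnitaryGroup (Fin 2) ℂ)) := {V | PlaqSmall θj V} with hW
  have hWopen : IsOpen W := by
    have e : W = ⋂ p : Plaq (F.P j) 0, {U | dist1 (GaugeField.plaqHol U p) < θj} := by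
      ext U; simp only [hW, PlaqSmall, Set.mem_setOf_eq, Set.mem_iInter]
    rw [e]
    exact isOpen_iInter_of_finite fun p => isOpen_lt (continuous_dist1_plaqHol p) continuous_const
  haveI : BorelSpace (GaugeField (F.P j) 0 ↥(Matrix.specialUnitaryGroup (Fin 2) ℂ)) := T3OrbitAverage.instBorelSpaceGaugeField
  haveI : BorelSpace (GaugeField (F.P (j + 1)) 0 ↥(Matrix.specialUnitaryGroup (Fin 2) ℂ)) := T3OrbitAverage.instBorelSpaceGaugeField
  have hWm : MeasurableSet W := hWopen.measurableSet
  -- the good set, the chart (spliced) and its Jacobian (terms)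
  set Good : Set (GaugeField (F.P j) 0 ↥(Matrix.specialUnitaryGroup (Fin 2) ℂ) × GaugeField (F.P (j + 1)) 0 ↥(Matrix.specialUnitaryGroup (Fin 2) ℂ)) :=
    {p | ∀ c, p.1 c ∈ T c p.2} with hGood
  let Φ₀ : GaugeField (F.P j) 0 ↥(Matrix.specialUnitaryGroup (Fin 2) ℂ) × GaugeField (F.P (j + 1)) 0 ↥(Matrix.specialUnitaryGroup (Fin 2) ℂ) →
      GaugeField (F.P (j + 1)) 0 ↥(Matrix.specialUnitaryGroup (Fin 2) ℂ) :=
    fun p => extend β (fun c => θ c p.2 (p.1 c)) p.2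
  let Φ : GaugeField (F.P j) 0 ↥(Matrix.specialUnitaryGroup (Fin 2) ℂ) × GaugeField (F.P (j + 1)) 0 ↥(Matrix.specialUnitaryGroup (Fin 2) ℂ) →
      GaugeField (F.P (j + 1)) 0 ↥(Matrix.specialUnitaryGroup (Fin 2) ℂ) :=
    Good.piecewise Φ₀ (fun p => s p.1)
  let J : GaugeField (F.P j) 0 ↥(Matrix.specialUnitaryGroup (Fin 2) ℂ) × GaugeField (F.P (j + 1)) 0 ↥(Matrix.specialUnitaryGroup (Fin 2) ℂ) → ℝ≥0 :=
    fun p => Good.indicator (fun p => ∏ c, jac c p.2 (p.1 c)) p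
  have hGoodm : MeasurableSet Good := T4TriangularFibredChart.measurableSet_forall_mem_fst T hTm
  have hΦ₀m : Measurable Φ₀ := T4TriangularFibredChart.measurable_triChart (β := β) θ hβi hθm
  have hΦm : Measurable Φ :=
    T4TriangularFibredChart.measurable_triChartSplice (β := β) T θ hβi hTm hθm (hsm : Measurable s)
  have hJm : Measurable J := T4TriangularFibredChart.measurable_triJacobian T jac hTm hjm
  -- the fibred chart identity of the T⁴ engine at `descend` (spliced)
  have hmap := T4TriangularFibredChart.pi_restrict_preimage_inter_eq_map_prod_withDensity_splice (β := β) (A := descend F ℰp j) Ω T θ jac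
    (HaarData.haar : Measure ↥(Matrix.specialUnitaryGroup (Fin 2) ℂ)) (HaarData.haar : Measure ↥(Matrix.specialUnitaryGroup (Fin 2) ℂ))
    hloc hβi hd hΩm hTm hθm hjm hΩbl hright hlaw s hWm
  -- the spliced chart lies over the window (everywhere)
  have havgΦ : ∀ V ∈ W, ∀ U, descend F ℰp j (Φ (V, U)) = V :=
    T4TriangularFibredChart.apply_triChartSplice_eq (β := β) (A := descend F ℰp j) T θ hloc hβi hright (σ := s) (U₀ := W) hs
  -- values of the chart and the Jacobian on / off the good set
  have hΦ_good : ∀ V U, (V, U) ∈ Good → Φ (V, U) = extend β (fun c => θ c U (V c)) U := fun V U h =>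
    Set.piecewise_eq_of_mem _ _ _ h
  have hJ_good : ∀ V U, (V, U) ∈ Good → J (V, U) = ∏ c, jac c U (V c) := fun V U h => indicator_of_mem h _
  have hJ_bad : ∀ V U, (V, U) ∉ Good → J (V, U) = 0 := fun V U h => indicator_of_notMem h _
  -- (C1′): continuity of the integrands on the window, for every environment
  have hint : ∀ f : GaugeField (F.P (j + 1)) 0 ↥(Matrix.specialUnitaryGroup (Fin 2) ℂ) → ℝ, Continuous f →
      (∀ U, f U ≠ 0 → PlaqSmall (cW * θ') U) →
      ∀ U : GaugeField (F.P (j + 1)) 0 ↥(Matrix.specialUnitaryGroup (Fin 2) ℂ), ContinuousOn (fun V => (J (V, U) : ℝ) * f (Φ (V, U))) W := by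
    intro f hf hsupp U
    -- the good slice and its inner companion
    set G : Set (GaugeField (F.P j) 0 ↥(Matrix.specialUnitaryGroup (Fin 2) ℂ)) := {V | ∀ c, V c ∈ T c U} with hG
    set G' : Set (GaugeField (F.P j) 0 ↥(Matrix.specialUnitaryGroup (Fin 2) ℂ)) := {V | ∀ c, V c ∈ T' c U} with hG'
    have hGopen : IsOpen G := by
      have e : G = ⋂ c, (fun V : GaugeField (F.P j) 0 ↥(Matrix.specialUnitaryGroup (Fin 2) ℂ) => V c) ⁻¹' T c U := by
        ext V; simp only [hG, Set.mem_setOf_eq, Set.mem_iInter, Set.mem_preimage]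
      rw [e]
      exact isOpen_iInter_of_finite fun c => (hTo c U).preimage (continuous_apply c)
    have hclG' : closure G' ⊆ G := by
      intro V hV c
      have h1 : V c ∈ closure (T' c U) := by
        have hcont : Continuous fun V' : GaugeField (F.P j) 0 ↥(Matrix.specialUnitaryGroup (Fin 2) ℂ) => V' c := continuous_apply c
        exact map_mem_closure (f := fun V' : GaugeField (F.P j) 0 ↥(Matrix.specialUnitaryGroup (Fin 2) ℂ) => V' c) (x := V)
          hcont hV fun V' hV' => hV' c
      exact hT'T c U h1
    -- the smooth branch on `G`
    have hbranch : ContinuousOn (fun V : GaugeField (F.P j) 0 ↥(Matrix.specialUnitaryGroup (Fin 2) ℂ) =>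
        (∏ c, (jac c U (V c) : ℝ)) * f (extend β (fun c => θ c U (V c)) U)) G := by
      have h1 : ContinuousOn (fun V : GaugeField (F.P j) 0 ↥(Matrix.specialUnitaryGroup (Fin 2) ℂ) => ∏ c, (jac c U (V c) : ℝ)) G :=
        continuousOn_finsetProd _ fun c _ => (hjc c U).comp (continuous_apply c).continuousOn fun V hV => hV c
      have h2 : ContinuousOn (fun V : GaugeField (F.P j) 0 ↥(Matrix.specialUnitaryGroup (Fin 2) ℂ) => fun c => θ c U (V c)) G :=
        continuousOn_pi.2 fun c => (hθc c U).comp (continuous_apply c).continuousOn fun V hV => hV c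
      exact h1.mul (hf.comp_continuousOn ((continuous_extend_left hβi U).comp_continuousOn h2))
    -- pointwise: inside `G` the integrand is the branch, outside `closure G'` it vanishes near the point
    intro V₀ hV₀
    by_cases hVG : V₀ ∈ G
    · have heq : (fun V => (J (V, U) : ℝ) * f (Φ (V, U))) =ᶠ[nhdsWithin V₀ W]
          fun V => (∏ c, (jac c U (V c) : ℝ)) * f (extend β (fun c => θ c U (V c)) U) := by
        filter_upwards [mem_nhdsWithin_of_mem_nhds (hGopen.mem_nhds hVG)] with V hV
        have hmem : (V, U) ∈ Good := hV
        simp only [hJ_good V U hmem, hΦ_good V U hmem, NNReal.coe_prod]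
      refine (ContinuousWithinAt.congr_of_eventuallyEq ?_ heq ?_)
      · exact ((hbranch V₀ hVG).continuousAt (hGopen.mem_nhds hVG)).continuousWithinAt
      · have hmem : (V₀, U) ∈ Good := hVG
        simp only [hJ_good V₀ U hmem, hΦ_good V₀ U hmem, NNReal.coe_prod]
    · -- off `G`: a neighbourhood within the window where the integrand vanishes
      have hV₀cl : V₀ ∉ closure G' := fun h => hVG (hclG' h)
      have hN : (closure G')ᶜ ∈ nhds V₀ := isClosed_closure.isOpen_compl.mem_nhds hV₀cl
      have hzero : ∀ V, V ∈ W → V ∉ closure G' → (J (V, U) : ℝ) * f (Φ (V, U)) = 0 := by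
        intro V hVW hVcl
        by_cases hVg : (V, U) ∈ Good
        · -- good but not inner-good: the chart point is not cW-small, so `f` vanishes
          have hnot : ¬ PlaqSmall (cW * θ') (extend β (fun c => θ c U (V c)) U) := by
            intro hsmall
            exact hVcl (subset_closure (hmargin U V hVW hVg hsmall))
          have hf0 : f (Φ (V, U)) = 0 := by
            rw [hΦ_good V U hVg]
            by_contra h
            exact hnot (hsupp _ h)
          rw [hf0, mul_zero]
        · rw [hJ_bad V U hVg, NNReal.coe_zero, zero_mul]
      have heq : (fun V => (J (V, U) : ℝ) * f (Φ (V, U))) =ᶠ[nhdsWithin V₀ W] fun _ => (0 : ℝ) := by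
        filter_upwards [mem_nhdsWithin_of_mem_nhds hN, self_mem_nhdsWithin] with V hV hVW
        exact hzero V hVW hV
      exact (continuousWithinAt_const.congr_of_eventuallyEq heq (hzero V₀ hV₀ hV₀cl))
  -- (C2): a constant bound on the Jacobian
  have hJB : ∀ V, V ∈ W → ∀ U, (J (V, U) : ℝ) ≤ ((M : ℝ) ^ Fintype.card (PBond (F.P j) 0)) := by
    intro V _ U
    have h1 : J (V, U) ≤ ∏ c : PBond (F.P j) 0, jac c U (V c) := by
      show Good.indicator (fun p => ∏ c, jac c p.2 (p.1 c)) (V, U) ≤ _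
      exact indicator_le_self _ _ _
    have h2 : ∏ c : PBond (F.P j) 0, jac c U (V c) ≤ ∏ _c : PBond (F.P j) 0, M :=
      Finset.prod_le_prod' fun c _ => hjM c U (V c)
    rw [Finset.prod_const, Finset.card_univ] at h2
    exact_mod_cast h1.trans h2
  -- (C3): the mass letter in the bridge's form
  have hmass' : ∀ V, PlaqSmall θj V →
      0 < ∫⁻ U in {U | PlaqSmall (cW * θ') (Φ (V, U))}, (J (V, U) : ℝ≥0∞)
        ∂(fieldMeasure (F.P (j + 1)) 0 ↥(Matrix.specialUnitaryGroup (Fin 2) ℂ)) := by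
    intro V hV
    refine (hmass V hV).trans_le ?_
    have hO₃m : MeasurableSet {U : GaugeField (F.P (j + 1)) 0 ↥(Matrix.specialUnitaryGroup (Fin 2) ℂ) | PlaqSmall (cW * θ') U} := by
      have e : {U : GaugeField (F.P (j + 1)) 0 ↥(Matrix.specialUnitaryGroup (Fin 2) ℂ) | PlaqSmall (cW * θ') U} =
          ⋂ p : Plaq (F.P (j + 1)) 0, {U | dist1 (GaugeField.plaqHol U p) < cW * θ'} := by
        ext U; simp only [PlaqSmall, Set.mem_setOf_eq, Set.mem_iInter]
      rw [e]
      exact (isOpen_iInter_of_finite fun p => isOpen_lt (continuous_dist1_plaqHol p) continuous_const).measurableSet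
    have hΦ₀Vm : Measurable fun U => Φ₀ (V, U) := hΦ₀m.comp measurable_prodMk_left
    have hA : MeasurableSet {U : GaugeField (F.P (j + 1)) 0 ↥(Matrix.specialUnitaryGroup (Fin 2) ℂ) | (∀ c, V c ∈ T c U) ∧
        PlaqSmall (cW * θ') (extend β (fun c => θ c U (V c)) U)} := by
      have e : {U : GaugeField (F.P (j + 1)) 0 ↥(Matrix.specialUnitaryGroup (Fin 2) ℂ) | (∀ c, V c ∈ T c U) ∧
          PlaqSmall (cW * θ') (extend β (fun c => θ c U (V c)) U)} =
          {U | (V, U) ∈ Good} ∩ (fun U => Φ₀ (V, U)) ⁻¹' {U | PlaqSmall (cW * θ') U} := by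
        ext U; rfl
      rw [e]
      exact (show MeasurableSet {U : GaugeField (F.P (j + 1)) 0 ↥(Matrix.specialUnitaryGroup (Fin 2) ℂ) | (V, U) ∈ Good} from
        measurable_prodMk_left hGoodm).inter (hΦ₀Vm hO₃m)
    -- on the good cW-small set the Jacobian IS the product and the spliced chart IS the chart: a sub-integral of the bridge's mass
    have key : ∀ A : Set (GaugeField (F.P (j + 1)) 0 ↥(Matrix.specialUnitaryGroup (Fin 2) ℂ)), MeasurableSet A →
        (∀ U ∈ A, (V, U) ∈ Good ∧ PlaqSmall (cW * θ') (extend β (fun c => θ c U (V c)) U)) →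
        ∫⁻ U in A, (∏ c, (jac c U (V c) : ℝ≥0∞)) ∂(fieldMeasure (F.P (j + 1)) 0 ↥(Matrix.specialUnitaryGroup (Fin 2) ℂ)) ≤
          ∫⁻ U in {U | PlaqSmall (cW * θ') (Φ (V, U))}, (J (V, U) : ℝ≥0∞)
            ∂(fieldMeasure (F.P (j + 1)) 0 ↥(Matrix.specialUnitaryGroup (Fin 2) ℂ)) := by
      intro A hAm hAin
      have h1 : ∫⁻ U in A, (∏ c, (jac c U (V c) : ℝ≥0∞)) ∂(fieldMeasure (F.P (j + 1)) 0 ↥(Matrix.specialUnitaryGroup (Fin 2) ℂ)) =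
          ∫⁻ U in A, (J (V, U) : ℝ≥0∞) ∂(fieldMeasure (F.P (j + 1)) 0 ↥(Matrix.specialUnitaryGroup (Fin 2) ℂ)) := by
        refine lintegral_congr_ae ((ae_restrict_iff' hAm).2 (Eventually.of_forall fun U hU => ?_))
        show (∏ c, (jac c U (V c) : ℝ≥0∞)) = ((J (V, U) : ℝ≥0) : ℝ≥0∞)
        rw [hJ_good V U (hAin U hU).1, ENNReal.ofNNReal_finsetProd]
      rw [h1]
      refine lintegral_mono_set fun U hU => ?_
      show PlaqSmall (cW * θ') (Φ (V, U))
      rw [hΦ_good V U (hAin U hU).1]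
      exact (hAin U hU).2
    exact key _ hA fun U hU => hU
  -- assemble through the integrand-level bridge
  haveI : IsProbabilityMeasure (fieldMeasure (F.P (j + 1)) 0 ↥(Matrix.specialUnitaryGroup (Fin 2) ℂ)) :=
    Missing.isProbabilityMeasure_fieldMeasure _ _
  exact Summit.QuantumFields.YangMills.Theorems.OrganTangentFibredChartBridgeIntegrandAnyCut.regularPackage_of_fibredChart_of_integrand
    F γ b₀ p₀ j cW σ₀ hσ₀M hbind₀ hfib₀
    (fieldMeasure (F.P (j + 1)) 0 ↥(Matrix.specialUnitaryGroup (Fin 2) ℂ)) Φ hΦm J hJm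
    {U | ∀ c, U (β c) ∈ Ω c U} (fun U hU c => hΩS U hU c) havgΦ hmap
    (fun f hf hsupp => Eventually.of_forall (hint f hf hsupp))
    (fun _ => (M : ℝ) ^ Fintype.card (PBond (F.P j) 0)) (integrable_const _)
    (fun V hV => Eventually.of_forall (hJB V hV)) hmass'

end Summit.QuantumFields.YangMills.Theorems.OrganTangentTriangularChartAnyCut

end
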